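import Mathlib
import HarnessLib
import Summits.AtomisticToContinuum.Crystallization.Theorems.ChargedEnergyGap.Negative.BlocksBound

/-!
# ContactSaturationLadderCauchyBornFloor — the Cauchy–Born energy density of every homogeneously deformed periodic crystal is `≥ e⋆` (helper, supports item 30303)

Helper for route `ContactSaturationLadder`, crux `LooseTextureRung` (stmt-AtomisticToContinuum-30303), registered line «DialFreeSieve» v5
(lens-1), stub `stub_thinClusterFloor8` and its CORE-FREE RUNG `ThinClusterFloor 5` (decomp-a2c lens-1 g18 memo v2.1 §6, bus l.1013): the
rung's world is defect-free, slowly modulated certified (Barlow-like) matter, and its mechanism is nonlinear ELASTICITY — Cauchy–Born energy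
density `≥ e⋆` for every homogeneous deformation (FREE, this file) + coercivity of the density near its well modulo rotations with certified
elastic constants (the XL piece) + a strain witness per loose particle + the chart.

This file proves the FREE zeroth-order piece (E1).  For a periodic configuration `Q` (Blanc–Lewin lattice `G` + motif) and a continuous
linear automorphism `F` of `ℝ³`, the homogeneous image `F·Q` is the periodic configuration `linImage Q F` (lattice `F(G)` realised as
`ZLattice.comap` along `F⁻¹`, motif `F(motif)`; `linImage_points : (linImage Q F).points = F '' Q.points`); its energy per particle is
`Q`'s own lattice sum with every distance read through `F` (`energyPerParticle_linImage` — the Cauchy–Born energy density per particle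
`W_Q(F)` written out), and therefore `e⋆ ≤ W_Q(F)` for EVERY `Q` and `F` (`cauchyBorn_floor`, from the tree's
`ChargedEnergyGapNegative.eStar_le`): a homogeneously strained crystal never undercuts `e⋆`, so an elastic lower bound for modulated
matter only has to pay for strain VARIATION.  No numerics, no Lennard-Jones specifics beyond `eStar_le`.
-/

noncomputable section

open scoped BigOperators
open Literature.MathematicalPhysics.StatisticalMechanics (lennardJones PeriodicConfiguration)
open Summit.AtomisticToContinuum.Crystallization.Theorems.ChargedEnergyGapNegative (eStar eStar_le)

namespace Summit.AtomisticToContinuum.Crystallization.Theorems.ContactSaturationLadderCauchyBornFloor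


variable (Q : PeriodicConfiguration 3) (F : EuclideanSpace ℝ (Fin 3) ≃L[ℝ] EuclideanSpace ℝ (Fin 3))

/-- The homogeneous (linear) image `F·Q` of a periodic configuration: lattice `F(G)` (as the comap along `F⁻¹`), motif `F(motif)`
(Blanc–Lewin 2015 §2.1 periodic configurations are closed under `GL₃(ℝ)`). [folklore] -/
def linImage : PeriodicConfiguration 3 where
  lattice := ZLattice.comap ℝ Q.lattice F.symm.toLinearMap
  discrete := inferInstance
  isZLattice := inferInstance
  motif := Q.motif.image F
  motif_nonempty := Q.motif_nonempty.image _
  eq_of_sub_mem := by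
    intro x hx y hy hxy
    simp only [Finset.mem_image] at hx hy
    obtain ⟨a, ha, rfl⟩ := hx
    obtain ⟨b, hb, rfl⟩ := hy
    rw [← SetLike.mem_coe, ZLattice.coe_comap, Set.mem_preimage, SetLike.mem_coe] at hxy
    have hab : a - b ∈ Q.lattice := by
      have h1 : F.symm.toLinearMap (F a - F b) = a - b := by simp [map_sub]
      rw [h1] at hxy
      exact hxy
    rw [Q.eq_of_sub_mem a ha b hb hab]

/-- Membership in the image lattice: `g ∈ F(G) ↔ F⁻¹ g ∈ G`. [folklore] -/
theorem mem_linImage_lattice {g : EuclideanSpace ℝ (Fin 3)} :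
    g ∈ (linImage Q F).lattice ↔ F.symm g ∈ Q.lattice := by
  show g ∈ ZLattice.comap ℝ Q.lattice F.symm.toLinearMap ↔ _
  rw [← SetLike.mem_coe, ZLattice.coe_comap, Set.mem_preimage, SetLike.mem_coe]
  simp

/-- The point set of `F·Q` is `F '' (points of Q)`. [folklore] -/
theorem linImage_points : (linImage Q F).points = F '' Q.points := by
  ext z
  simp only [PeriodicConfiguration.points, Set.mem_setOf_eq, Set.mem_image]
  constructor
  · rintro ⟨y, hy, g, hg, rfl⟩
    have hy' : y ∈ Q.motif.image F := hy
    rw [Finset.mem_image] at hy'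
    obtain ⟨a, ha, rfl⟩ := hy'
    rw [mem_linImage_lattice] at hg
    refine ⟨a + F.symm g, ⟨a, ha, F.symm g, hg, rfl⟩, ?_⟩
    simp [map_add]
  · rintro ⟨b, ⟨a, ha, h, hh, rfl⟩, rfl⟩
    refine ⟨F a, ?_, F h, ?_, by simp [map_add]⟩
    · show F a ∈ Q.motif.image F
      exact Finset.mem_image_of_mem _ ha
    · rw [mem_linImage_lattice]; simpa using hh

/-- **The Cauchy–Born energy density written out**: the energy per particle of `F·Q` is the lattice sum of `Q` with all distances read
through `F`. [folklore] -/
theorem energyPerParticle_linImage (V : ℝ → ℝ) :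
    (linImage Q F).energyPerParticle V =
      (2 * (Q.motif.card : ℝ))⁻¹ * ∑ a ∈ Q.motif, ∑' b : {b // b ∈ Q.points ∧ b ≠ a}, V (dist (F a) (F b.1)) := by
  unfold PeriodicConfiguration.energyPerParticle
  have hm : (linImage Q F).motif = Q.motif.image F := rfl
  have hc : ((linImage Q F).motif.card : ℝ) = Q.motif.card := by
    rw [hm, Finset.card_image_of_injective _ F.injective]
  rw [hc, hm, Finset.sum_image fun a _ b _ h => F.injective h]
  congr 1
  refine Finset.sum_congr rfl fun a _ => ?_
  have hpts := linImage_points Q F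
  let e : {b // b ∈ Q.points ∧ b ≠ a} ≃ {y // y ∈ (linImage Q F).points ∧ y ≠ F a} :=
    { toFun := fun b => ⟨F b.1, by
          refine ⟨?_, fun h => b.2.2 (F.injective h)⟩
          rw [hpts]; exact ⟨b.1, b.2.1, rfl⟩⟩
      invFun := fun y => ⟨F.symm y.1, by
          obtain ⟨hy, hne⟩ := y.2
          obtain ⟨b, hb, hbF⟩ := (Set.ext_iff.1 hpts y.1).1 hy
          refine ⟨?_, fun h => hne ?_⟩
          · rw [← hbF]; simpa using hb
          · have h2 : F (F.symm y.1) = F a := congrArg F h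
            have h3 : F (F.symm y.1) = y.1 := by simp
            exact h3.symm.trans h2⟩
      left_inv := fun b => by ext : 1; simp
      right_inv := fun y => by ext : 1; simp }
  rw [← Equiv.tsum_eq e]
  rfl

/-- **THE CAUCHY–BORN FLOOR** (piece E1 of the core-free rung, decomp-a2c lens-1 g18 memo v2.1 §6): for every periodic configuration `Q` and every continuous linear automorphism `F`
of `ℝ³`, the Cauchy–Born energy per particle of the homogeneously deformed crystal `F·Q` is at least `e⋆`. -/
theorem cauchyBorn_floor :
    eStar ≤ (2 * (Q.motif.card : ℝ))⁻¹ * ∑ a ∈ Q.motif, ∑' b : {b // b ∈ Q.points ∧ b ≠ a}, lennardJones (dist (F a) (F b.1)) := by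
  rw [← energyPerParticle_linImage]
  exact eStar_le _

/-- The floor in `PeriodicConfiguration` form. [folklore] -/
theorem eStar_le_linImage : eStar ≤ (linImage Q F).energyPerParticle lennardJones := eStar_le _

end Summit.AtomisticToContinuum.Crystallization.Theorems.ContactSaturationLadderCauchyBornFloor
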